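import Mathlib
import Literature.Geometry.Riemannian.SphericalZonalGaussianBounds
import HarnessLib

/-!
# Certificate infrastructure (3/4): real-analysis envelope lemmas for the interval checker

Helper file for the line `conformal-kernel-domination` of the crux
`Summit.SmoothPoincare4.SmoothPoincare4.Theses.CylinderEntropy.SliceIsolation` (crux item
stmt-SmoothPoincare4-7632).  The kernel-domination certificates compare, cell by cell, the pulled-back
conformal Gaussian
`pulled(T,u,s) = (8π²/3)((4πT)²)⁻¹ e^{4u} e^{-Q/(4T)}`, `Q = e^{2u} - 2 eᵘ s + 1 = (eᵘ - s)² + 1 - s²`,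
with finite sums of zonal atoms `w · zonal(τ, s) · e^{-(u-σ)²/(4τ)}` (`zonal` the typed zonal heat
kernel of `S⁴`).  A computable interval checker over `ℚ` (run by `native_decide`) needs, on each box
`u ∈ [u₁,u₂]`, `s ∈ [s₁,s₂]`, `T ∈ [T₁,T₂]`, an explicit UPPER bound for `pulled` and explicit LOWER
bounds for the atoms.  This file supplies the real-analysis lemmas the soundness proof of that checker
invokes (no definitions):

* `helper_certTsup` — the exact `T`-envelope: `T ↦ T⁻² e^{-Q₀/(4T)}` attains its sup on `[T₁,T₂]` at
  `max T₁ (min (Q₀/8) T₂)`, after `Q ≥ Q₀` has been used;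
* `Cert.Q_lower` — the box lower bound `Q ≥ (clamp(s₂; a, b) - s₂)² + 1 - s₂²` for `eᵘ ∈ [a,b]`,
  `s ≤ s₂`;
* `Cert.pulled_prefactor`, `Cert.pulled_le_of_le_u`, `Cert.pulled_le_of_u_le` — the prefactor identity
  `(8π²/3)((4πT)²)⁻¹ = (6T²)⁻¹` and the two `u`-tails of `pulled`;
* `Cert.arccos_sq_le`, `Cert.arccos_sq_le_ten` — `arccos(s)² ≤ 6 - 2√(3 + 6s)` on `[-1/2, 1]`
  (from `sin x ≥ x - x³/6`) and `arccos(s)² ≤ 9.87`;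
* `Cert.exp_quad_lower`, `Cert.zonal_pole_gauss_le` — the Gaussian factor and Hamilton's minorant
  `zonal τ 1 · e^{-Θ/(4τlo)} ≤ zonal τ s` (`arccos(s)² ≤ Θ`, `τlo ≤ τ`) on a box;
* `Cert.le_neg_log_div_two`, `Cert.neg_log_div_two_le` — enclosing `τ = -(log q)/2`.
-/

-- the registered namespace `Summit.SmoothPoincare4.SmoothPoincare4.Theorems…` repeats a component
set_option linter.dupNamespace false

namespace Summit.SmoothPoincare4.SmoothPoincare4.Theorems.CylinderEntropySliceIsolation

open Literature.Geometry.Riemannian.SphericalCylinderEntropy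
  Literature.Geometry.Riemannian.SphericalZonalKernelSeries

namespace Cert

/-! ### The `T`-envelope -/

/-- Two-point comparison for `g(t) = t⁻² e^{-Q₀/(4t)}`: if `(b - a)(8b - Q₀) ≤ 0` (i.e. `b` lies
between `a` and the critical point `Q₀/8`) then `g a ≤ g b`.  Proof: `b/a ≤ e^{b/a - 1}`, so
`(b/a)² ≤ e^{2(b/a - 1)} ≤ e^{Q₀/(4a) - Q₀/(4b)}`. [folklore] -/
theorem Tsup_two_point (a b Q₀ : ℝ) (ha : 0 < a) (hb : 0 < b) (h : (b - a) * (8 * b - Q₀) ≤ 0) :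
    (a ^ 2)⁻¹ * Real.exp (-Q₀ / (4 * a)) ≤ (b ^ 2)⁻¹ * Real.exp (-Q₀ / (4 * b)) := by
  have h' : 2 * (b / a - 1) ≤ Q₀ / (4 * a) - Q₀ / (4 * b) := by
    have e : Q₀ / (4 * a) - Q₀ / (4 * b) - 2 * (b / a - 1) =
        -((b - a) * (8 * b - Q₀)) / (4 * a * b) := by
      field_simp
      ring
    have : 0 ≤ -((b - a) * (8 * b - Q₀)) / (4 * a * b) := div_nonneg (by linarith) (by positivity)
    linarith
  have h1 : b / a ≤ Real.exp (b / a - 1) := by linarith [Real.add_one_le_exp (b / a - 1)]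
  have h2 : (b / a) ^ 2 ≤ Real.exp (Q₀ / (4 * a) - Q₀ / (4 * b)) := by
    calc (b / a) ^ 2 ≤ Real.exp (b / a - 1) ^ 2 := pow_le_pow_left₀ (by positivity) h1 2
      _ = Real.exp (2 * (b / a - 1)) := by rw [sq, ← Real.exp_add]; ring_nf
      _ ≤ Real.exp (Q₀ / (4 * a) - Q₀ / (4 * b)) := Real.exp_le_exp.2 h'
  have k1 : (a ^ 2)⁻¹ * Real.exp (-Q₀ / (4 * a)) =
      (b ^ 2)⁻¹ * ((b / a) ^ 2 * Real.exp (-Q₀ / (4 * a))) := by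
    field_simp
  have k2 : (b ^ 2)⁻¹ * Real.exp (-Q₀ / (4 * b)) =
      (b ^ 2)⁻¹ * (Real.exp (Q₀ / (4 * a) - Q₀ / (4 * b)) * Real.exp (-Q₀ / (4 * a))) := by
    rw [← Real.exp_add]
    congr 2
    ring
  rw [k1, k2]
  gcongr

/-- The `T`-envelope with `Q₀` fixed: for `0 < T₁ ≤ T ≤ T₂`,
`T⁻² e^{-Q₀/(4T)} ≤ Tc⁻² e^{-Q₀/(4Tc)}` with `Tc = max T₁ (min (Q₀/8) T₂)` (the function increases up
to `Q₀/8` and decreases afterwards; no sign condition on `Q₀` is needed). [folklore] -/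
theorem Tsup_fixed (T₁ T₂ T Q₀ : ℝ) (hT₁ : 0 < T₁) (h1 : T₁ ≤ T) (h2 : T ≤ T₂) :
    (T ^ 2)⁻¹ * Real.exp (-Q₀ / (4 * T)) ≤
      ((max T₁ (min (Q₀ / 8) T₂)) ^ 2)⁻¹ * Real.exp (-Q₀ / (4 * max T₁ (min (Q₀ / 8) T₂))) := by
  have hT : 0 < T := hT₁.trans_le h1
  rcases le_total (Q₀ / 8) T₂ with hQT | hTQ
  · rw [min_eq_left hQT]
    rcases le_total T₁ (Q₀ / 8) with hTQ' | hQT'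
    · rw [max_eq_right hTQ']
      have hQ : 0 < Q₀ / 8 := hT₁.trans_le hTQ'
      exact Tsup_two_point T (Q₀ / 8) Q₀ hT hQ (le_of_eq (by ring))
    · rw [max_eq_left hQT']
      exact Tsup_two_point T T₁ Q₀ hT hT₁ (by nlinarith)
  · rw [min_eq_right hTQ, max_eq_right (h1.trans h2)]
    exact Tsup_two_point T T₂ Q₀ hT (hT.trans_le h2) (by nlinarith)

/-! ### The box bound on `Q` and the prefactor -/

/-- Box lower bound for `Q = e^{2u} - 2 eᵘ s + 1`: for `a ≤ eᵘ ≤ b` and `s ≤ s₂`,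
`(max a (min s₂ b) - s₂)² + (1 - s₂²) ≤ Q` (`Q` decreases in `s`, and `(r - s₂)²` on `[a, b]` is least
at the clamp of `s₂`). [folklore] -/
theorem Q_lower (u s s₂ a b : ℝ) (ha : a ≤ Real.exp u) (hb : Real.exp u ≤ b) (hs : s ≤ s₂) :
    (max a (min s₂ b) - s₂) ^ 2 + (1 - s₂ ^ 2) ≤ Real.exp (2 * u) - 2 * Real.exp u * s + 1 := by
  have hr := Real.exp_pos u
  have h2u : Real.exp (2 * u) = Real.exp u ^ 2 := by rw [sq, ← Real.exp_add]; ring_nf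
  rw [h2u]
  have hmono : (Real.exp u - s₂) ^ 2 + (1 - s₂ ^ 2) ≤ Real.exp u ^ 2 - 2 * Real.exp u * s + 1 := by
    nlinarith [mul_le_mul_of_nonneg_left hs hr.le]
  refine le_trans ?_ hmono
  have hcl : (max a (min s₂ b) - s₂) ^ 2 ≤ (Real.exp u - s₂) ^ 2 := by
    rcases le_total s₂ b with hsb | hbs
    · rw [min_eq_left hsb]
      rcases le_total a s₂ with has | hsa
      · rw [max_eq_right has]; nlinarith
      · rw [max_eq_left hsa]; nlinarith
    · rw [min_eq_right hbs, max_eq_right (ha.trans hb)]; nlinarith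
  linarith

/-- The prefactor identity `(8π²/3)((4πT)²)⁻¹ = (6T²)⁻¹` (`T ≠ 0`). [folklore] -/
theorem pulled_prefactor (T : ℝ) (hT : T ≠ 0) :
    (8 * Real.pi ^ 2 / 3) * ((4 * Real.pi * T) ^ 2)⁻¹ = (6 * T ^ 2)⁻¹ := by
  have hπ : Real.pi ≠ 0 := Real.pi_ne_zero
  field_simp
  ring

/-! ### The two `u`-tails of `pulled` -/

/-- **Large-`u` tail.** For `0 < T₁ ≤ T ≤ T₂`, `U ≤ u`, `|s| ≤ 1` and `8T₂ ≤ e^U (e^U - 1)`: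
`pulled(T,u,s) ≤ (6T₁²)⁻¹ exp(4U - (e^U - 1)²/(4T₂))`.  Indeed `Q ≥ (eᵘ - 1)²`
(`Q - (eᵘ-1)² = 2eᵘ(1-s)`), and `h(u) = 4u - (eᵘ - 1)²/(4T₂)` is non-increasing on `[U, ∞)`:
`(eᵘ-1)² - (e^U-1)² = (eᵘ - e^U)(eᵘ + e^U - 2) ≥ e^U (u-U) · 2(e^U - 1) ≥ 16 T₂ (u - U)`. [folklore] -/
theorem pulled_le_of_le_u (T₁ T₂ T u U s : ℝ) (hT₁ : 0 < T₁) (h1 : T₁ ≤ T) (h2 : T ≤ T₂)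
    (hU : U ≤ u) (hbig : 8 * T₂ ≤ Real.exp U * (Real.exp U - 1)) (hs1 : -1 ≤ s) (hs2 : s ≤ 1) :
    (8 * Real.pi ^ 2 / 3) * ((4 * Real.pi * T) ^ 2)⁻¹ * Real.exp (4 * u) *
        Real.exp (-(Real.exp (2 * u) - 2 * Real.exp u * s + 1) / (4 * T)) ≤
      (6 * T₁ ^ 2)⁻¹ * Real.exp (4 * U - (Real.exp U - 1) ^ 2 / (4 * T₂)) := by
  have hT : 0 < T := hT₁.trans_le h1
  have hT₂ : 0 < T₂ := hT.trans_le h2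
  rw [pulled_prefactor T hT.ne']
  have hr := Real.exp_pos u
  have hR := Real.exp_pos U
  have h2u : Real.exp (2 * u) = Real.exp u ^ 2 := by rw [sq, ← Real.exp_add]; ring_nf
  -- `hs1` belongs to the checker's uniform calling convention; only `hs2` is needed below
  have _h : -1 ≤ s := hs1
  -- `Q ≥ (eᵘ - 1)²`
  have hQ : (Real.exp u - 1) ^ 2 ≤ Real.exp (2 * u) - 2 * Real.exp u * s + 1 := by
    rw [h2u]; nlinarith [hs2, hr]
  have hE : Real.exp (-(Real.exp (2 * u) - 2 * Real.exp u * s + 1) / (4 * T)) ≤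
      Real.exp (-(Real.exp u - 1) ^ 2 / (4 * T₂)) := by
    refine Real.exp_le_exp.2 ?_
    rw [neg_div, neg_div, neg_le_neg_iff]
    calc (Real.exp u - 1) ^ 2 / (4 * T₂) ≤ (Real.exp u - 1) ^ 2 / (4 * T) :=
          div_le_div_of_nonneg_left (sq_nonneg _) (by positivity) (by linarith)
      _ ≤ _ := div_le_div_of_nonneg_right hQ (by positivity)
  have hP : (6 * T ^ 2)⁻¹ ≤ (6 * T₁ ^ 2)⁻¹ := by
    refine inv_anti₀ (by positivity) ?_
    nlinarith
  -- `e^U > 1`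
  have hUpos : 0 < Real.exp U - 1 := by
    by_contra hcon
    push Not at hcon
    have : Real.exp U * (Real.exp U - 1) ≤ 0 := mul_nonpos_of_nonneg_of_nonpos hR.le hcon
    linarith
  have huU : Real.exp U ≤ Real.exp u := Real.exp_le_exp.2 hU
  have hdiff : Real.exp U * (u - U) ≤ Real.exp u - Real.exp U := by
    have h0 := Real.add_one_le_exp (u - U)
    have he : Real.exp u = Real.exp U * Real.exp (u - U) := by rw [← Real.exp_add]; ring_nf
    rw [he]; nlinarith
  have hmono : 4 * u - (Real.exp u - 1) ^ 2 / (4 * T₂) ≤ 4 * U - (Real.exp U - 1) ^ 2 / (4 * T₂) := by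
    have hprod : Real.exp U * (u - U) * (2 * (Real.exp U - 1)) ≤
        (Real.exp u - Real.exp U) * (Real.exp u + Real.exp U - 2) :=
      mul_le_mul hdiff (by linarith) (by linarith) (by linarith)
    have hb2 : 8 * T₂ * (u - U) ≤ Real.exp U * (Real.exp U - 1) * (u - U) :=
      mul_le_mul_of_nonneg_right hbig (sub_nonneg.2 hU)
    have hring : (Real.exp u - 1) ^ 2 - (Real.exp U - 1) ^ 2 =
        (Real.exp u - Real.exp U) * (Real.exp u + Real.exp U - 2) := by ring
    have hkey : 16 * T₂ * (u - U) ≤ (Real.exp u - 1) ^ 2 - (Real.exp U - 1) ^ 2 := by linarith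
    have h4 : 4 * (u - U) ≤ ((Real.exp u - 1) ^ 2 - (Real.exp U - 1) ^ 2) / (4 * T₂) := by
      rw [le_div_iff₀ (by positivity)]; nlinarith
    have hsplit : ((Real.exp u - 1) ^ 2 - (Real.exp U - 1) ^ 2) / (4 * T₂) =
        (Real.exp u - 1) ^ 2 / (4 * T₂) - (Real.exp U - 1) ^ 2 / (4 * T₂) := by ring
    linarith
  calc (6 * T ^ 2)⁻¹ * Real.exp (4 * u) *
        Real.exp (-(Real.exp (2 * u) - 2 * Real.exp u * s + 1) / (4 * T))
      ≤ (6 * T₁ ^ 2)⁻¹ * Real.exp (4 * u) * Real.exp (-(Real.exp u - 1) ^ 2 / (4 * T₂)) := by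
        gcongr
    _ = (6 * T₁ ^ 2)⁻¹ * Real.exp (4 * u - (Real.exp u - 1) ^ 2 / (4 * T₂)) := by
        rw [mul_assoc, ← Real.exp_add]
        congr 2
        ring
    _ ≤ (6 * T₁ ^ 2)⁻¹ * Real.exp (4 * U - (Real.exp U - 1) ^ 2 / (4 * T₂)) := by
        gcongr

/-- **Small-`u` tail.** For `0 < T₁ ≤ T ≤ T₂`, `u ≤ U` and `|s| ≤ 1`:
`pulled(T,u,s) ≤ (6T₁²)⁻¹ e^{4U}` (`Q = (eᵘ - s)² + 1 - s² ≥ 0`, so the last factor is `≤ 1`).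
[folklore] -/
theorem pulled_le_of_u_le (T₁ T₂ T u U s : ℝ) (hT₁ : 0 < T₁) (h1 : T₁ ≤ T) (h2 : T ≤ T₂)
    (hU : u ≤ U) (hs1 : -1 ≤ s) (hs2 : s ≤ 1) :
    (8 * Real.pi ^ 2 / 3) * ((4 * Real.pi * T) ^ 2)⁻¹ * Real.exp (4 * u) *
        Real.exp (-(Real.exp (2 * u) - 2 * Real.exp u * s + 1) / (4 * T)) ≤
      (6 * T₁ ^ 2)⁻¹ * Real.exp (4 * U) := by
  have hT : 0 < T := hT₁.trans_le h1
  -- `h2` belongs to the checker's uniform calling convention (it gives `0 < T₂`, not needed below)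
  have _hT₂ : 0 < T₂ := hT.trans_le h2
  rw [pulled_prefactor T hT.ne']
  have hr := Real.exp_pos u
  have h2u : Real.exp (2 * u) = Real.exp u ^ 2 := by rw [sq, ← Real.exp_add]; ring_nf
  have hQ : 0 ≤ Real.exp (2 * u) - 2 * Real.exp u * s + 1 := by
    rw [h2u]
    nlinarith [mul_nonneg (sub_nonneg.2 hs2) (show 0 ≤ s + 1 by linarith), sq_nonneg (Real.exp u - s)]
  have hE : Real.exp (-(Real.exp (2 * u) - 2 * Real.exp u * s + 1) / (4 * T)) ≤ 1 := by
    rw [Real.exp_le_one_iff, neg_div, neg_nonpos]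
    positivity
  have hP : (6 * T ^ 2)⁻¹ ≤ (6 * T₁ ^ 2)⁻¹ := by
    refine inv_anti₀ (by positivity) ?_
    nlinarith
  calc (6 * T ^ 2)⁻¹ * Real.exp (4 * u) *
        Real.exp (-(Real.exp (2 * u) - 2 * Real.exp u * s + 1) / (4 * T))
      ≤ (6 * T₁ ^ 2)⁻¹ * Real.exp (4 * U) * 1 := by
        gcongr
    _ = (6 * T₁ ^ 2)⁻¹ * Real.exp (4 * U) := mul_one _

/-! ### Angular bounds -/

/-- `1 - cos x ≥ (x²/2)(1 - x²/24)²` for `0 ≤ x`, `x² ≤ 24` (`1 - cos x = 2 sin²(x/2)` and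
`sin y ≥ y - y³/6`). [folklore] -/
theorem one_sub_cos_ge (x : ℝ) (hx0 : 0 ≤ x) (hx24 : x ^ 2 ≤ 24) :
    x ^ 2 / 2 * (1 - x ^ 2 / 24) ^ 2 ≤ 1 - Real.cos x := by
  have e1 : 1 - Real.cos x = 2 * Real.sin (x / 2) ^ 2 := by
    rw [Real.sin_sq_eq_half_sub, show 2 * (x / 2) = x by ring]; ring
  have e2 : x / 2 - (x / 2) ^ 3 / 6 ≤ Real.sin (x / 2) := Real.sin_ge_sub_cube (by linarith)
  have e3 : 0 ≤ x / 2 - (x / 2) ^ 3 / 6 := by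
    have : (x / 2) ^ 3 / 6 = x / 2 * (x ^ 2 / 24) := by ring
    rw [this]; nlinarith
  have e4 := pow_le_pow_left₀ e3 e2 2
  calc x ^ 2 / 2 * (1 - x ^ 2 / 24) ^ 2 = 2 * (x / 2 - (x / 2) ^ 3 / 6) ^ 2 := by ring
    _ ≤ 2 * Real.sin (x / 2) ^ 2 := by linarith
    _ = 1 - Real.cos x := e1.symm

/-- **`arccos(s)² ≤ 6 - 2√(3 + 6s)` on `[-1/2, 1]`.**  With `θ = arccos s ∈ [0, 2π/3]` and `x = θ²`:
`1 - s ≥ x/2 - x²/24`, i.e. `(x - 6)² ≥ 4(3 + 6s)`, and `x ≤ (2π/3)² < 6` excludes the upper branch.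
[folklore] -/
theorem arccos_sq_le (s : ℝ) (h1 : -1 / 2 ≤ s) (h2 : s ≤ 1) :
    Real.arccos s ^ 2 ≤ 6 - 2 * Real.sqrt (3 + 6 * s) := by
  set θ := Real.arccos s with hθ
  have hθ0 : 0 ≤ θ := Real.arccos_nonneg s
  have hθπ : θ ≤ Real.pi := Real.arccos_le_pi s
  have hs1 : -1 ≤ s := by linarith
  have hcos : Real.cos θ = s := Real.cos_arccos hs1 h2
  have hc23 : Real.cos (2 * Real.pi / 3) = -1 / 2 := by
    rw [show 2 * Real.pi / 3 = Real.pi - Real.pi / 3 by ring, Real.cos_pi_sub,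
      Real.cos_pi_div_three]
    norm_num
  have hθle : θ ≤ 2 * Real.pi / 3 := by
    by_contra hcon
    push Not at hcon
    have hlt : Real.cos θ < Real.cos (2 * Real.pi / 3) :=
      Real.cos_lt_cos_of_nonneg_of_le_pi (by positivity) hθπ hcon
    rw [hcos, hc23] at hlt
    linarith
  have hx6 : θ ^ 2 ≤ 6 := by
    have hπ := Real.pi_lt_d2
    have h21 : θ ≤ 2.1 := hθle.trans (by linarith)
    nlinarith
  have key : θ ^ 2 / 2 * (1 - θ ^ 2 / 24) ^ 2 ≤ 1 - s := by
    have h := one_sub_cos_ge θ hθ0 (by linarith)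
    rwa [hcos] at h
  set y := Real.sqrt (3 + 6 * s) with hy
  have hy0 : 0 ≤ y := Real.sqrt_nonneg _
  have hy2 : y ^ 2 = 3 + 6 * s := Real.sq_sqrt (by linarith)
  have hlow : θ ^ 2 / 2 - (θ ^ 2) ^ 2 / 24 ≤ 1 - s := by
    nlinarith [key, pow_nonneg (sq_nonneg θ) 3]
  have hquad : 0 ≤ (θ ^ 2 - 6 - 2 * y) * (θ ^ 2 - 6 + 2 * y) := by
    have expand : (θ ^ 2 - 6 - 2 * y) * (θ ^ 2 - 6 + 2 * y) =
        24 * ((1 - s) - (θ ^ 2 / 2 - (θ ^ 2) ^ 2 / 24)) := by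
      rw [show (θ ^ 2 - 6 - 2 * y) * (θ ^ 2 - 6 + 2 * y) = (θ ^ 2 - 6) ^ 2 - 4 * y ^ 2 by ring,
        hy2]
      ring
    rw [expand]
    linarith
  by_contra hcon
  push Not at hcon
  have hneg : θ ^ 2 - 6 - 2 * y < 0 := by nlinarith
  have hpos : 0 < θ ^ 2 - 6 + 2 * y := by linarith
  have := mul_neg_of_neg_of_pos hneg hpos
  linarith

/-- `arccos(s)² ≤ π² ≤ 9.87`. [folklore] -/
theorem arccos_sq_le_ten (s : ℝ) : Real.arccos s ^ 2 ≤ 987 / 100 := by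
  have h0 : 0 ≤ Real.arccos s := Real.arccos_nonneg s
  have hπ : Real.arccos s ≤ Real.pi := Real.arccos_le_pi s
  have hd := Real.pi_lt_d4
  have h : Real.arccos s ≤ 3.1416 := by linarith
  nlinarith

/-! ### The Gaussian factor and Hamilton's minorant on a box -/

/-- The Gaussian factor on a box: for `u ∈ [u₁, u₂]` and `0 < τlo ≤ τ`,
`exp(-(max |u₁ - σ| |u₂ - σ|)²/(4τlo)) ≤ exp(-(u - σ)²/(4τ))`. [folklore] -/
theorem exp_quad_lower (u u₁ u₂ σ τ τlo : ℝ) (hτlo : 0 < τlo) (hτ : τlo ≤ τ) (h1 : u₁ ≤ u)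
    (h2 : u ≤ u₂) :
    Real.exp (-(max |u₁ - σ| |u₂ - σ|) ^ 2 / (4 * τlo)) ≤ Real.exp (-(u - σ) ^ 2 / (4 * τ)) := by
  have hτ0 : 0 < τ := hτlo.trans_le hτ
  have habs : |u - σ| ≤ max |u₁ - σ| |u₂ - σ| :=
    abs_le_max_abs_abs (by linarith) (by linarith)
  have hM0 : 0 ≤ max |u₁ - σ| |u₂ - σ| := (abs_nonneg _).trans habs
  have hsq : (u - σ) ^ 2 ≤ (max |u₁ - σ| |u₂ - σ|) ^ 2 := by
    rw [← sq_abs (u - σ)]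
    exact pow_le_pow_left₀ (abs_nonneg _) habs 2
  refine Real.exp_le_exp.2 ?_
  rw [neg_div, neg_div, neg_le_neg_iff]
  calc (u - σ) ^ 2 / (4 * τ) ≤ (max |u₁ - σ| |u₂ - σ|) ^ 2 / (4 * τ) :=
        div_le_div_of_nonneg_right hsq (by positivity)
    _ ≤ (max |u₁ - σ| |u₂ - σ|) ^ 2 / (4 * τlo) :=
        div_le_div_of_nonneg_left (sq_nonneg _) (by positivity) (by linarith)

/-- **Hamilton's minorant on a box.** For `0 < τlo ≤ τ`, `s ∈ [-1, 1]` and `arccos(s)² ≤ Θ`: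
`zonal τ 1 · e^{-Θ/(4τlo)} ≤ zonal τ s` (the tree's `zonal_one_mul_exp_neg_arccos_sq_le_zonal` and
monotonicity of the Gaussian factor). [folklore] -/
theorem zonal_pole_gauss_le (τ τlo Θ s : ℝ) (hτlo : 0 < τlo) (hτ : τlo ≤ τ) (hs1 : -1 ≤ s)
    (hs2 : s ≤ 1) (hΘ : Real.arccos s ^ 2 ≤ Θ) :
    zonal τ 1 * Real.exp (-Θ / (4 * τlo)) ≤ zonal τ s := by
  have hτ0 : 0 < τ := hτlo.trans_le hτ
  refine le_trans ?_ (zonal_one_mul_exp_neg_arccos_sq_le_zonal hτ0 hs1 hs2)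
  have h1 : 0 < zonal τ 1 := lt_of_lt_of_le one_pos (one_le_zonal_one hτ0)
  refine mul_le_mul_of_nonneg_left (Real.exp_le_exp.2 ?_) h1.le
  have hΘ0 : 0 ≤ Θ := (sq_nonneg _).trans hΘ
  rw [neg_div, neg_div, neg_le_neg_iff]
  calc Real.arccos s ^ 2 / (4 * τ) ≤ Θ / (4 * τ) := div_le_div_of_nonneg_right hΘ (by positivity)
    _ ≤ Θ / (4 * τlo) := div_le_div_of_nonneg_left hΘ0 (by positivity) (by linarith)

/-! ### Enclosing `τ = -(log q)/2` -/

/-- If `0 < q ≤ e^{-2 tlo}` then `tlo ≤ -(log q)/2`. [folklore] -/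
theorem le_neg_log_div_two (q tlo : ℝ) (hq : 0 < q) (h : q ≤ Real.exp (-2 * tlo)) :
    tlo ≤ -(Real.log q) / 2 := by
  have h' : Real.log q ≤ -2 * tlo := (Real.log_le_iff_le_exp hq).2 h
  linarith

/-- If `e^{-2 thi} ≤ q` then `-(log q)/2 ≤ thi`. [folklore] -/
theorem neg_log_div_two_le (q thi : ℝ) (hq : 0 < q) (h : Real.exp (-2 * thi) ≤ q) :
    -(Real.log q) / 2 ≤ thi := by
  have h' : -2 * thi ≤ Real.log q := (Real.le_log_iff_exp_le hq).2 h
  linarith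

end Cert

/-- **The exact `T`-envelope (registered helper).** For `0 < T₁ ≤ T ≤ T₂` and `0 ≤ Q₀ ≤ Q`:
`T⁻² e^{-Q/(4T)} ≤ Tc⁻² e^{-Q₀/(4Tc)}` with `Tc = max T₁ (min (Q₀/8) T₂)`: first `Q ≥ Q₀`, then
`g(T) = T⁻² e^{-Q₀/(4T)}` increases on `(0, Q₀/8]` and decreases on `[Q₀/8, ∞)`. [folklore] -/
theorem helper_certTsup : ∀ (T₁ T₂ T Q Q₀ : ℝ), 0 < T₁ → T₁ ≤ T → T ≤ T₂ → 0 ≤ Q₀ → Q₀ ≤ Q → (T ^ 2)⁻¹ * Real.exp (-Q / (4 * T)) ≤ ((max T₁ (min (Q₀ / 8) T₂)) ^ 2)⁻¹ * Real.exp (-Q₀ / (4 * max T₁ (min (Q₀ / 8) T₂))) := by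
  intro T₁ T₂ T Q Q₀ hT₁ h1 h2 _ hQ
  have hT : 0 < T := hT₁.trans_le h1
  refine le_trans ?_ (Cert.Tsup_fixed T₁ T₂ T Q₀ hT₁ h1 h2)
  refine mul_le_mul_of_nonneg_left (Real.exp_le_exp.2 ?_) (by positivity)
  rw [neg_div, neg_div, neg_le_neg_iff]
  exact div_le_div_of_nonneg_right hQ (by positivity)

end Summit.SmoothPoincare4.SmoothPoincare4.Theorems.CylinderEntropySliceIsolation
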